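import Summits.Ventures.QEC.CircuitDistance.SchedK2InstBB144o345X
import HarnessLib

/-!
# Q4 #345 (K2 instance, `[[144,12,12]]` under CNOT order #345, sector X): the instance CHECK (`check₂`, index data) by
# `decide +kernel`, `Good` for ANY word list (the instance has no stop witnesses), and «every `o345XTable` class is a slot»
# (cell `qec`, experiment CDX; seat qec-cdx-type-2 g1; twin of type-1's `PortK2InstBB144CheckX` + the class half of `…Final`)

Nothing here asserts a value of `d_circ`.
-/

namespace Summit.Ventures.QEC.CircuitDistance

open Literature.InformationTheory.QuantumCodes Finset K2

set_option maxRecDepth 100000 in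
/-- KERNEL: the #345 X instance passes the consistency check `check₂` against `H^Z` (syndrome table = `H^Z` syndromes of the
slot supports, logical table = parities against `lsupp345X`, live masks, translation closure via `closIdx345X`, pivots);
the stop-witness part is vacuous (empty stop lists, empty word list). -/
theorem check345X : inst345X.check₂ (fun j q => bb144SM.toCode.HZ j q) [] closIdx345X [[], [], [], [], []] = true := by
  decide +kernel

/-- Hence the #345 X instance is `Good` against `H^Z` for EVERY word list: `Good` depends on the words only through the
stop witnesses, and `inst345X` has none. -/
theorem good345X (words : List (List (Finset (BB.Mono 12 6 ⊕ BB.Mono 12 6)))) :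
    inst345X.Good (fun j q => bb144SM.toCode.HZ j q) words := by
  have g := K2Inst.good_of_check₂ _ _ _ _ _ check345X
  refine ⟨g.hN, g.hNK, g.hlives, g.hC, g.hmono, g.nodup, g.wf, g.z0, g.syn, g.lg, g.live, g.clos, g.piv,
    fun k hk msk hmsk => ?_⟩
  exfalso
  have hk5 : k < 5 := lt_of_lt_of_eq hk (by rfl)
  interval_cases k <;> simp [inst345X] at hmsk

set_option maxRecDepth 100000 in
/-- KERNEL: every X class of `o345XTable` (32 kinds with a class × 72 base indices) is one of the 360 slot supports. -/
theorem classes345XOK_true : classes345XOK = true := by decide +kernel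

/-- Unpacked: a table class `g` (`IsXClass o345XTable g`) is a listed support of the instance. -/
theorem mem_gsupp345X_of_isXClass {g : Finset (BB.Mono 12 6 ⊕ BB.Mono 12 6)} (hg : IsXClass o345XTable g) :
    g ∈ inst345X.gsupp := by
  have hall := classes345XOK_true
  unfold classes345XOK at hall
  simp only [List.all_eq_true] at hall
  obtain ⟨k, hk, i, hi⟩ := hg
  have h := hall k hk i (mem_monoList i)
  cases hck : o345XTable.cls k with
  | none => rw [hck] at hi; exact absurd hi (by simp)
  | some g₀ =>
    rw [hck] at hi h
    simp only [Option.map_some, Option.some.injEq] at hi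
    simp only [decide_eq_true_eq] at h
    rw [← hi]; exact h

end Summit.Ventures.QEC.CircuitDistance
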